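import Literature.RepresentationTheory.BorelWallach2000.U11ContragredientSocle
import Literature.Algebra.Module.LoewySeriesLattice
import HarnessLib

/-!
# The contragredient exchanges the two Loewy series: `(socⁿ M)^⊥ = radⁿ(M~)`, `(radⁿ M)^⊥ = socⁿ(M~)`, `ℓℓ(M~) = ht(M)`,
# and the Loewy layers are dual, for admissible `(𝔤, K)`-modules of `U(1,1)` (Borel–Wallach 0 §2.5; Krause, Conventions)

Family `hodge`, lane `lit-hodgefound` (foundations library; seat `lit-hodgefound-p39`, generation 34, row g34-#2); topic
`RepresentationTheory/BorelWallach2000`, namespace `…BorelWallach2000.U11DualFunctor` (continued).  Sequel of g33-#5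
(`U11ContragredientSocle`: `(soc M)^⊥ = rad(M~)`, `(rad M)^⊥ = soc(M~)`), of g32-#10 (`annOrderIso : Sub_R(M) ≃o Sub_R(M~)ᵒᵈ` for
admissible `M`, `R = GKRing G11` the operator ring), of g32-#11 (`subquotientDualEquiv : U^⊥/U′^⊥ ≅ (U′/U)~`) and of g34-#1
(`Literature.Algebra.Module.LoewySeriesLattice`: under ANY anti-isomorphism of submodule lattices the socle series goes to the radical
series, `e(socⁿ M) = radⁿ M′`, and `ht(M) = ℓℓ(M′)`).  What is formalised, for an admissible `(𝔤, K)`-module `M` of `U(1,1)`: the whole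
socle series of `M` is annihilated onto the radical series of the contragredient `M~` and vice versa, **`(socⁿ M)^⊥ = radⁿ(M~)`**,
**`(radⁿ M)^⊥ = socⁿ(M~)`** (and `(socⁿ M~)_⊥ = radⁿ M`, `(radⁿ M~)_⊥ = socⁿ M`); the termination indices are exchanged,
**`ℓℓ(M~) = ht(M)`**, **`ht(M~) = ℓℓ(M)`** — so that for `M` of finite length, where `ht = ℓℓ` (g33-#14), **`ℓℓ(M~) = ℓℓ(M)`**; and the
LOEWY LAYERS are dual `(𝔤, K)`-modules: **`radⁿ(M~)/radⁿ⁺¹(M~) ≅ (socⁿ⁺¹ M/socⁿ M)~`**, **`socⁿ⁺¹(M~)/socⁿ(M~) ≅ (radⁿ M/radⁿ⁺¹ M)~`**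
over `R`.  One plumbing definition with body (`factorCongr`, transport of consecutive quotients along equal pairs) and two named
equivalences + theorems; 0 `sorry`, no named fact (net debt 0, D-0026), no instance, no notation.

## The sources

Borel–Wallach [BorelWallach2000, 0 §2.5, I §2.2] (the contragredient `(𝔤, K)`-module `Ṽ`; for admissible `V`, `V` is contragredient
to `Ṽ`); Knapp–Vogan [KnappVogan1995, §II.3 Prop. 2.53 (b)] (exactness of `W ↦ W^c`: subquotients dualise); Krause [Krause2021,
Conventions p. xxiv «Socle», «Radical»] (`socⁿ`, `radⁿ`, `ht`, Loewy length; §11.2 p. 360: for `ℓ(X) < ∞`, `ht(X)` «equals the smallest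
`n ≥ 0` such that `radⁿ(X) = 0`»); Anderson–Fuller [AndersonFuller1992, §32 p. 346] (upper = radical, lower = socle Loewy series and
their factors).  The exchange is the lattice statement g34-#1 `ofDual_map_socleSeries` instantiated at `annOrderIso` — proved, not quoted.

## What is formalised (`G = U(1,1)`, `R = GKRing G11`, `M~ = GKDual.dualModule`, `M` admissible unless said otherwise)

* §1 **`ann_socleSeries : (socⁿ M)^⊥ = radⁿ(M~)`**, **`ann_radicalSeries : (radⁿ M)^⊥ = socⁿ(M~)`**, `perp_socleSeries`, `perp_radicalSeries`.
* §2 `socleSeries_dualModule_eq_top_iff` (`socⁿ(M~) = M~ ⟺ radⁿ M = 0`), `radicalSeries_dualModule_eq_bot_iff` (`radⁿ(M~) = 0 ⟺ socⁿ M = M`),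
  **`loewyLength_dualModule : ℓℓ(M~) = ht(M)`**, **`socleLength_dualModule : ht(M~) = ℓℓ(M)`**; for `M` of FINITE LENGTH (admissibility
  then automatic, `U11HC.isAdmissibleGK_of_isFiniteLength`): **`loewyLength_dualModule_eq : ℓℓ(M~) = ℓℓ(M)`**,
  **`socleLength_dualModule_eq : ht(M~) = ht(M)`**.
* §3 Loewy layers: `factorCongr` (plumbing), **`socleLayerDualEquiv n : radⁿ(M~)/radⁿ⁺¹(M~) ≃ₗ[R] (socⁿ⁺¹ M/socⁿ M)~`**,
  **`radicalLayerDualEquiv n : socⁿ⁺¹(M~)/socⁿ(M~) ≃ₗ[R] (radⁿ M/radⁿ⁺¹ M)~`** (both layers in the trunk's consecutive-quotient format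
  `GKRing.Factor (A, B) = ↥B ⧸ A.comap B.subtype`).

## Mathlib / Literature search

g32-#10 `annOrderIso`, `annOrderIso_apply`, `perp_ann`; g32-#11 `subquotientDualEquiv`; g33-#14 `socleSeries`, `radicalSeries`,
`socleSeries_mono`, `radicalSeries_antitone`, `loewyLength_eq_socleLength`; g34-#1 `ofDual_map_socleSeries`, `ofDual_map_radicalSeries`,
`socleSeries_eq_top_iff_of_antiIso`, `radicalSeries_eq_bot_iff_of_antiIso`, `socleLength_eq_loewyLength_of_antiIso`,
`loewyLength_eq_socleLength_of_antiIso`; `U11HC.isAdmissibleGK_of_isFiniteLength`; Mathlib `Submodule.Quotient.equiv`, `LinearEquiv.ofEq`,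
`isFiniteLength_iff_isNoetherian_isArtinian`.  `rg -n 'ann_socleSeries|LayerDualEquiv|loewyLength_dualModule'` → nothing in the tree.

## References

* A. Borel, N. Wallach, *Continuous Cohomology, Discrete Subgroups, and Representations of Reductive Groups*, 2nd ed., AMS (2000),
  0 §2.5, I §2.2. [BorelWallach2000]
* H. Krause, *Homological Theory of Representations*, CUP (2021), Conventions and Notations (p. xxiv); §11.2 (p. 360). [Krause2021]
* F. W. Anderson, K. R. Fuller, *Rings and Categories of Modules*, 2nd ed., GTM 13 (1992), §32 (p. 346). [AndersonFuller1992]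
* A. W. Knapp, D. A. Vogan, *Cohomological Induction and Unitary Representations* (1995), §II.3 Prop. 2.53 (b). [KnappVogan1995]
-/

noncomputable section

open scoped Matrix ComplexConjugate
open Module

namespace Literature.RepresentationTheory.BorelWallach2000

open Literature.Algebra.Lie Literature.Algebra.Lie.ChevalleyEilenberg
open Literature.Algebra.Module
open Literature.NumberTheory.Automorphic
open Literature.RepresentationTheory.KonnoKonno2007 Literature.RepresentationTheory.KonnoKonno2007.RealDualPair
open Literature.RepresentationTheory.KonnoKonno2007.RealDualPair.UForm
open Literature.LinearAlgebra
open U11HolDS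

-- Mathlib idiom (as in `GKModules`, `GKCohomology`): commutator bracket on `Module.End` / matrices
attribute [local instance 100] LieRing.ofAssociativeRing

namespace U11DualFunctor

-- as in the trunk's `GKModuleRing` §8 (`GKRing.Factor`): quotients of submodule subtypes `↥Y ⧸ X.comap Y.subtype` over `GKRing G`
-- need nested instance synthesis one level deeper than the default
set_option maxSynthPendingDepth 4

variable {M : Type*} [AddCommGroup M] [Module ℂ M] [Module (GKRing G11) M] [IsScalarTower ℂ (GKRing G11) M]
  (hM : IsGKModule G11 (GKRing.actK G11 M) (GKRing.actLie G11 M))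

/-! ## §1 `(socⁿ M)^⊥ = radⁿ(M~)` and `(radⁿ M)^⊥ = socⁿ(M~)` -/

/-- **`(socⁿ M)^⊥ = radⁿ(M~)` for every `n`**, for an admissible `(𝔤, K)`-module `M` of `U(1,1)`: the anti-isomorphism `U ↦ U^⊥` of
submodule lattices (g32-#10) carries the socle series onto the radical series (g34-#1). [cite: BorelWallach2000, 0 §2.5, I §2.2]
[cite: Krause2021, Conventions «Socle», «Radical»] -/
theorem ann_socleSeries (hadm : IsAdmissibleGK (GKRing.actK G11 M)) (n : ℕ) :
    GKDual.ann G11 hM (SocleRadical.socleSeries (GKRing G11) M n) =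
      SocleRadical.radicalSeries (GKRing G11) (GKDual.dualModule G11 hM) n := by
  rw [← annOrderIso_apply hM hadm]
  exact SocleRadical.ofDual_map_socleSeries (annOrderIso hM hadm) n

/-- **`(radⁿ M)^⊥ = socⁿ(M~)` for every `n`** (admissible `M`). [cite: BorelWallach2000, 0 §2.5, I §2.2]
[cite: Krause2021, Conventions «Socle», «Radical»] -/
theorem ann_radicalSeries (hadm : IsAdmissibleGK (GKRing.actK G11 M)) (n : ℕ) :
    GKDual.ann G11 hM (SocleRadical.radicalSeries (GKRing G11) M n) =
      SocleRadical.socleSeries (GKRing G11) (GKDual.dualModule G11 hM) n := by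
  rw [← annOrderIso_apply hM hadm]
  exact SocleRadical.ofDual_map_radicalSeries (annOrderIso hM hadm) n

/-- Dually, `(socⁿ(M~))_⊥ = radⁿ M`. [cite: BorelWallach2000, 0 §2.5, I §2.2] [cite: Krause2021, Conventions «Socle», «Radical»] -/
theorem perp_socleSeries (hadm : IsAdmissibleGK (GKRing.actK G11 M)) (n : ℕ) :
    GKDual.perp G11 hM (SocleRadical.socleSeries (GKRing G11) (GKDual.dualModule G11 hM) n) =
      SocleRadical.radicalSeries (GKRing G11) M n := by
  rw [← ann_radicalSeries hM hadm, perp_ann]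

/-- … and `(radⁿ(M~))_⊥ = socⁿ M`. [cite: BorelWallach2000, 0 §2.5, I §2.2] [cite: Krause2021, Conventions «Socle», «Radical»] -/
theorem perp_radicalSeries (hadm : IsAdmissibleGK (GKRing.actK G11 M)) (n : ℕ) :
    GKDual.perp G11 hM (SocleRadical.radicalSeries (GKRing G11) (GKDual.dualModule G11 hM) n) =
      SocleRadical.socleSeries (GKRing G11) M n := by
  rw [← ann_socleSeries hM hadm, perp_ann]

/-! ## §2 Termination indices: `ℓℓ(M~) = ht(M)`, `ht(M~) = ℓℓ(M)`; finite length: `ℓℓ(M~) = ℓℓ(M)` -/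

/-- `socⁿ(M~) = M~ ⟺ radⁿ M = 0` (admissible `M`). [cite: BorelWallach2000, 0 §2.5, I §2.2] [cite: Krause2021, Conventions «Socle», «Radical»] -/
theorem socleSeries_dualModule_eq_top_iff (hadm : IsAdmissibleGK (GKRing.actK G11 M)) (n : ℕ) :
    SocleRadical.socleSeries (GKRing G11) (GKDual.dualModule G11 hM) n = ⊤ ↔ SocleRadical.radicalSeries (GKRing G11) M n = ⊥ :=
  (SocleRadical.radicalSeries_eq_bot_iff_of_antiIso (annOrderIso hM hadm) n).symm

/-- `radⁿ(M~) = 0 ⟺ socⁿ M = M` (admissible `M`). [cite: BorelWallach2000, 0 §2.5, I §2.2] [cite: Krause2021, Conventions «Socle», «Radical»] -/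
theorem radicalSeries_dualModule_eq_bot_iff (hadm : IsAdmissibleGK (GKRing.actK G11 M)) (n : ℕ) :
    SocleRadical.radicalSeries (GKRing G11) (GKDual.dualModule G11 hM) n = ⊥ ↔ SocleRadical.socleSeries (GKRing G11) M n = ⊤ :=
  (SocleRadical.socleSeries_eq_top_iff_of_antiIso (annOrderIso hM hadm) n).symm

/-- **`ℓℓ(M~) = ht(M)`: the Loewy length of the contragredient is the height of `M`** (admissible `M`; Krause's conventions: both are `0`
if the series does not terminate). [cite: BorelWallach2000, 0 §2.5, I §2.2] [cite: Krause2021, Conventions «Socle», «Radical»; §11.2 (p. 360)] -/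
theorem loewyLength_dualModule (hadm : IsAdmissibleGK (GKRing.actK G11 M)) :
    SocleRadical.loewyLength (GKRing G11) (GKDual.dualModule G11 hM) = SocleRadical.socleLength (GKRing G11) M :=
  (SocleRadical.socleLength_eq_loewyLength_of_antiIso (annOrderIso hM hadm)).symm

/-- **`ht(M~) = ℓℓ(M)`** (admissible `M`). [cite: BorelWallach2000, 0 §2.5, I §2.2] [cite: Krause2021, Conventions «Socle», «Radical»; §11.2 (p. 360)] -/
theorem socleLength_dualModule (hadm : IsAdmissibleGK (GKRing.actK G11 M)) :
    SocleRadical.socleLength (GKRing G11) (GKDual.dualModule G11 hM) = SocleRadical.loewyLength (GKRing G11) M :=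
  (SocleRadical.loewyLength_eq_socleLength_of_antiIso (annOrderIso hM hadm)).symm

/-- **`ℓℓ(M~) = ℓℓ(M)` for a `(𝔤, K)`-module of `U(1,1)` of FINITE LENGTH** (then `M` is admissible, `U11HC.isAdmissibleGK_of_isFiniteLength`,
and Artinian, so `ht(M) = ℓℓ(M)`, g33-#14). [cite: BorelWallach2000, 0 §2.5, I §2.2] [cite: Krause2021, §11.2 (p. 360)] [cite: AndersonFuller1992, §32 (p. 346)] -/
theorem loewyLength_dualModule_eq (hfl : IsFiniteLength (GKRing G11) M) :
    SocleRadical.loewyLength (GKRing G11) (GKDual.dualModule G11 hM) = SocleRadical.loewyLength (GKRing G11) M := by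
  have hadm := U11HC.isAdmissibleGK_of_isFiniteLength hM hfl
  obtain ⟨_, _⟩ := (isFiniteLength_iff_isNoetherian_isArtinian.mp hfl)
  rw [loewyLength_dualModule hM hadm, SocleRadical.loewyLength_eq_socleLength]

/-- **`ht(M~) = ht(M)` for `M` of finite length.** [cite: BorelWallach2000, 0 §2.5, I §2.2] [cite: Krause2021, §11.2 (p. 360)] -/
theorem socleLength_dualModule_eq (hfl : IsFiniteLength (GKRing G11) M) :
    SocleRadical.socleLength (GKRing G11) (GKDual.dualModule G11 hM) = SocleRadical.socleLength (GKRing G11) M := by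
  have hadm := U11HC.isAdmissibleGK_of_isFiniteLength hM hfl
  obtain ⟨_, _⟩ := (isFiniteLength_iff_isNoetherian_isArtinian.mp hfl)
  rw [socleLength_dualModule hM hadm, SocleRadical.loewyLength_eq_socleLength]

/-! ## §3 The Loewy layers are dual: `radⁿ(M~)/radⁿ⁺¹(M~) ≅ (socⁿ⁺¹ M/socⁿ M)~`, `socⁿ⁺¹(M~)/socⁿ(M~) ≅ (radⁿ M/radⁿ⁺¹ M)~` -/

section Plumbing

variable {S : Type*} [Ring S] {V : Type*} [AddCommGroup V] [Module S V]

/-- Plumbing: the consecutive quotient `↥B ⧸ A ∩ B` transported along equal pairs `A = A′`, `B = B′`. [folklore] -/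
def factorCongr {A A' B B' : Submodule S V} (hA : A = A') (hB : B = B') :
    (↥B ⧸ A.comap B.subtype) ≃ₗ[S] (↥B' ⧸ A'.comap B'.subtype) :=
  Submodule.Quotient.equiv (A.comap B.subtype) (A'.comap B'.subtype) (LinearEquiv.ofEq B B' hB) (by
    subst hA
    subst hB
    ext x
    simp only [Submodule.mem_map, Submodule.mem_comap, Submodule.subtype_apply]
    constructor
    · rintro ⟨y, hy, rfl⟩
      simpa using hy
    · intro hx
      exact ⟨x, by simpa using hx, by ext; simp⟩)

/-- Unfolding on classes: `factorCongr [b] = [b]` (plumbing check). [folklore] -/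
@[simp] private theorem factorCongr_mk {A A' B B' : Submodule S V} (hA : A = A') (hB : B = B') (b : B) :
    factorCongr hA hB (Submodule.Quotient.mk b) = Submodule.Quotient.mk (LinearEquiv.ofEq B B' hB b) := rfl

end Plumbing

/-- **The socle layers of `M` and the radical layers of `M~` are dual: `radⁿ(M~)/radⁿ⁺¹(M~) ≅ (socⁿ⁺¹ M/socⁿ M)~` over `R`** (admissible
`M`; subquotient duality `U^⊥/U′^⊥ ≅ (U′/U)~`, g32-#11, at `U = socⁿ M ≤ U′ = socⁿ⁺¹ M`, and §1). [cite: BorelWallach2000, 0 §2.5, I §2.2]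
[cite: KnappVogan1995, §II.3 Prop. 2.53 (b)] [cite: AndersonFuller1992, §32 (p. 346)] [cite: Krause2021, Conventions «Socle», «Radical»] -/
def socleLayerDualEquiv (hadm : IsAdmissibleGK (GKRing.actK G11 M)) (n : ℕ) :
    GKRing.Factor (SocleRadical.radicalSeries (GKRing G11) (GKDual.dualModule G11 hM) (n + 1),
        SocleRadical.radicalSeries (GKRing G11) (GKDual.dualModule G11 hM) n) ≃ₗ[GKRing G11]
      GKDual.dualModule G11 (GKRing.isGKModule_factor G11 M
        (SocleRadical.socleSeries (GKRing G11) M n, SocleRadical.socleSeries (GKRing G11) M (n + 1)) hM) :=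
  factorCongr (ann_socleSeries hM hadm (n + 1)).symm (ann_socleSeries hM hadm n).symm ≪≫ₗ
    subquotientDualEquiv hM (SocleRadical.socleSeries_mono (GKRing G11) M (Nat.le_succ n))

/-- **The radical layers of `M` and the socle layers of `M~` are dual: `socⁿ⁺¹(M~)/socⁿ(M~) ≅ (radⁿ M/radⁿ⁺¹ M)~` over `R`** (admissible `M`).
[cite: BorelWallach2000, 0 §2.5, I §2.2] [cite: KnappVogan1995, §II.3 Prop. 2.53 (b)] [cite: AndersonFuller1992, §32 (p. 346)]
[cite: Krause2021, Conventions «Socle», «Radical»] -/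
def radicalLayerDualEquiv (hadm : IsAdmissibleGK (GKRing.actK G11 M)) (n : ℕ) :
    GKRing.Factor (SocleRadical.socleSeries (GKRing G11) (GKDual.dualModule G11 hM) n,
        SocleRadical.socleSeries (GKRing G11) (GKDual.dualModule G11 hM) (n + 1)) ≃ₗ[GKRing G11]
      GKDual.dualModule G11 (GKRing.isGKModule_factor G11 M
        (SocleRadical.radicalSeries (GKRing G11) M (n + 1), SocleRadical.radicalSeries (GKRing G11) M n) hM) :=
  factorCongr (ann_radicalSeries hM hadm n).symm (ann_radicalSeries hM hadm (n + 1)).symm ≪≫ₗ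
    subquotientDualEquiv hM (SocleRadical.radicalSeries_antitone (GKRing G11) M (Nat.le_succ n))

end U11DualFunctor

end Literature.RepresentationTheory.BorelWallach2000
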